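import Literature.Geometry.Lorentzian.KerrDataSchwarzschildMetric
import Literature.Geometry.Lorentzian.KerrSchildCoord
import HarnessLib

/-!
# The Schwarzschild metric in ingoing Kerr–Schild Cartesian coordinates, I: the components and
# their first derivatives in closed form

Support file (all results proved) for the verification that the Schwarzschild metric
`g = η + (2M/r) ℓ ⊗ ℓ`, `ℓ = (1, x⃗/r)` — the `a = 0` member `Kerr.bilin M 0` of the Kerr–Schild
family of `KerrSchild.lean` — is **Ricci-flat** (`Kerr.isRicciFlat M 0 r₀`, proved in
`SchwarzschildKerrSchildRicciFlat.lean`; Schwarzschild 1916; Kerr–Schild 1965, §3; O'Neill 1995,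
Ch. 2, Thm. 2.6.1 / Ch. 1 (Schwarzschild is a vacuum solution)).

Everything is written on all of `E4` through the scalar "atoms" of a point `x` (spatial part
`x⃗ = E4.spatial x`, `r = ‖x⃗‖ = E4.spatialNorm x`) and of constant vectors `V, W ∈ E4`: the time
components `V 0`, the spatial pairings `sdot V W = ⟪V⃗, W⃗⟫`, `sdot x V = ⟪x⃗, V⃗⟫`, and `r`:

* `Kerr.scalarH_zero_spin`, `Kerr.nullCovector_zero_spin_apply`, `Kerr.bilin_zero_spin_apply` —
  `H = M/r`, `ℓ(V) = V⁰ + ⟪x⃗, V⃗⟫/r`, `g(V, W) = −V⁰W⁰ + ⟪V⃗, W⃗⟫ + (2M/r) ℓ(V) ℓ(W)` at `a = 0`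
  (Visser arXiv:0706.0622, (32)–(34));
* `Schwarzschild.ell/nu/proj` — `ℓ(V)`, `ν(V) = ⟪x⃗, V⃗⟫/r` and the projected (angular) pairing
  `P(V, W) = ⟪V⃗, W⃗⟫ − ν(V) ν(W)`, with their derivatives off the time axis
  `∂_V ℓ(W) = ∂_V ν(W) = P(V, W)/r` (`Schwarzschild.dEll`, `hasFDerivAt_ell`, `hasFDerivAt_nu`) and
  `∂_V P(A, B) = −(P(V, A) ν(B) + ν(A) P(V, B))/r` (`Schwarzschild.dProj`, `hasFDerivAt_proj`);
* `Schwarzschild.fderiv_bilin_zero_spin_apply` — **the first derivatives of the components**,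
  `∂_V g(A, B) = (2M/r²)(−ν(V) ℓ(A) ℓ(B) + P(V, A) ℓ(B) + ℓ(A) P(V, B))` (Kerr–Schild 1965, §2).

The sequel `SchwarzschildKerrSchildKoszul.lean` computes the Koszul form (Christoffel symbols of
the first kind) and its derivative from these.

## References

* K. Schwarzschild, Sitzungsber. Preuss. Akad. Wiss. (1916) 189.
* R. P. Kerr, A. Schild, *A new class of vacuum solutions of the Einstein field equations* (1965),
  §§2–3.
* B. O'Neill, *The geometry of Kerr black holes* (1995), Ch. 2.
* M. Visser, *The Kerr spacetime: a brief introduction*, arXiv:0706.0622, (32)–(35).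
-/

noncomputable section

-- instance search through the nested operator types (as in `ChartCurvature`)
set_option maxSynthPendingDepth 3

open Bundle TopologicalSpace Manifold Set Module Filter
open scoped ContDiff Topology InnerProductSpace

namespace Literature.Geometry.Lorentzian

namespace Kerr

/-! ### The Kerr–Schild quantities at `a = 0` on all of `E4` -/

/-- The Euclidean pairing of `E4` splits into time and space parts:
`⟪v, w⟫ = v⁰ w⁰ + ⟪v⃗, w⃗⟫`. [folklore] -/
theorem inner_eq_time_add_spatial (v w : E4) :
    ⟪v, w⟫_ℝ = v 0 * w 0 + ⟪E4.spatial v, E4.spatial w⟫_ℝ := by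
  simp only [PiLp.inner_apply, RCLike.inner_apply, conj_trivial, Fin.sum_univ_four,
    Fin.sum_univ_three, E4.spatial_apply, Fin.isValue, Fin.succ_zero_eq_one, Fin.succ_one_eq_two]
  have h3 : (2 : Fin 3).succ = (3 : Fin 4) := rfl
  simp only [h3]
  ring

/-- `η(v, w) = −v⁰ w⁰ + ⟪v⃗, w⃗⟫` (O'Neill 1983, Ch. 3, p. 55). [cite: ONeill1983, Ch. 3, p. 55] -/
theorem minkowski_bilin_eq_spatial (v w : E4) :
    Minkowski.bilin v w = -(v 0 * w 0) + ⟪E4.spatial v, E4.spatial w⟫_ℝ := by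
  rw [Minkowski.bilin_apply]
  congr 1
  simp only [PiLp.inner_apply, RCLike.inner_apply, conj_trivial, Fin.sum_univ_three,
    E4.spatial_apply, Fin.isValue, Fin.succ_zero_eq_one, Fin.succ_one_eq_two]
  have h3 : (2 : Fin 3).succ = (3 : Fin 4) := rfl
  simp only [h3]
  ring

/-- `⟪x⃗, v⃗⟫ = x¹v¹ + x²v² + x³v³` in coordinates. [folklore] -/
theorem inner_spatial_eq (x v : E4) :
    ⟪E4.spatial x, E4.spatial v⟫_ℝ = x 1 * v 1 + x 2 * v 2 + x 3 * v 3 := by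
  simp only [PiLp.inner_apply, RCLike.inner_apply, conj_trivial, Fin.sum_univ_three,
    E4.spatial_apply, Fin.isValue, Fin.succ_zero_eq_one, Fin.succ_one_eq_two]
  have h3 : (2 : Fin 3).succ = (3 : Fin 4) := rfl
  simp only [h3]
  ring

/-- For `a = 0`, `H = M / r` with `r = ‖x⃗‖` (`H = M r³ / r⁴`; `r ≠ 0`). Visser arXiv:0706.0622,
(33). [cite: arXiv07060622, (33)] -/
theorem scalarH_zero_spin (M : ℝ) {x : E4} (hx : E4.spatialNorm x ≠ 0) :
    scalarH M 0 x = M / E4.spatialNorm x := by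
  rw [scalarH, radius_zero_left]
  have h0 : (0 : ℝ) ^ 2 * x 3 ^ 2 = 0 := by ring
  rw [h0, add_zero]
  field_simp

/-- For `a = 0`, the Kerr–Schild covector is `ℓ = (1, x⃗/r)`: `ℓ(v) = v⁰ + ⟪x⃗, v⃗⟫ / r`
(Visser arXiv:0706.0622, (34); at `r = 0` both sides read `v⁰`). [cite: arXiv07060622, (34)] -/
theorem nullCovector_zero_spin_apply (x v : E4) :
    nullCovector 0 x v = v 0 + ⟪E4.spatial x, E4.spatial v⟫_ℝ / E4.spatialNorm x := by
  rw [nullCovector, E4.covector_apply, Fin.sum_univ_four, inner_spatial_eq]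
  simp only [nullCovectorFun, radius_zero_left, Fin.isValue, Matrix.cons_val_zero,
    Matrix.cons_val_one, Matrix.cons_val, zero_mul, add_zero, sub_zero, one_mul]
  by_cases hr : E4.spatialNorm x = 0
  · simp [hr]
  · field_simp
    ring

/-- **The Schwarzschild metric in ingoing Kerr–Schild Cartesian coordinates**:
`g_{M,0}(v, w) = −v⁰w⁰ + ⟪v⃗, w⃗⟫ + (2M/r) ℓ(v) ℓ(w)`, `ℓ(v) = v⁰ + ⟪x⃗, v⃗⟫/r`, at every point
with `r = ‖x⃗‖ ≠ 0`. Visser arXiv:0706.0622, (32)–(34) with `a = 0`; Dafermos–Rodnianski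
arXiv:0811.0354, §5.1. [cite: arXiv07060622, (32)–(34)] -/
theorem bilin_zero_spin_apply (M : ℝ) {x : E4} (hx : E4.spatialNorm x ≠ 0) (v w : E4) :
    bilin M 0 x v w = -(v 0 * w 0) + ⟪E4.spatial v, E4.spatial w⟫_ℝ +
      2 * M / E4.spatialNorm x *
        ((v 0 + ⟪E4.spatial x, E4.spatial v⟫_ℝ / E4.spatialNorm x) *
          (w 0 + ⟪E4.spatial x, E4.spatial w⟫_ℝ / E4.spatialNorm x)) := by
  rw [bilin_apply, scalarH_zero_spin M hx, nullCovector_zero_spin_apply,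
    nullCovector_zero_spin_apply, minkowski_bilin_eq_spatial]
  ring

end Kerr

namespace Schwarzschild

/-! ### The atoms: spatial pairings, `ℓ`, `ν`, `P`, and their derivatives -/

/-- The spatial pairing `⟪v⃗, w⃗⟫` of two vectors of `E4`. [folklore] -/
def sdot (v w : E4) : ℝ := ⟪E4.spatial v, E4.spatial w⟫_ℝ

/-- The spatial pairing is symmetric. [folklore] -/
theorem sdot_comm (v w : E4) : sdot v w = sdot w v := real_inner_comm _ _

/-- `r² = ⟪x⃗, x⃗⟫`. [folklore] -/
theorem spatialNorm_sq_eq_sdot (x : E4) : E4.spatialNorm x ^ 2 = sdot x x := by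
  rw [sdot, E4.spatialNorm, real_inner_self_eq_norm_sq]

/-- The covector `v ↦ ⟪w⃗, v⃗⟫` on `E4`. [folklore] -/
def sdotCLM (w : E4) : E4 →L[ℝ] ℝ := (E3.covec (E4.spatial w)).comp E4.spatial

/-- `sdotCLM w v = ⟪w⃗, v⃗⟫`. [folklore] -/
@[simp]
theorem sdotCLM_apply (w v : E4) : sdotCLM w v = sdot w v := rfl

/-- `x ↦ ⟪x⃗, w⃗⟫` is linear, with derivative `v ↦ ⟪w⃗, v⃗⟫`. [folklore] -/
theorem hasFDerivAt_sdot_left (x w : E4) : HasFDerivAt (fun x : E4 ↦ sdot x w) (sdotCLM w) x :=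
  (Kerr.hasFDerivAt_inner_left (E4.spatial x) (E4.spatial w)).comp x E4.spatial.hasFDerivAt

/-- `D(c ‖·⃗‖⁻ⁿ)(x) = −c n r^{−(n+2)} ⟪x⃗, ·⃗⟫` away from the time axis. [folklore] -/
theorem hasFDerivAt_const_div_spatialNorm_pow (c : ℝ) {x : E4} (hx : E4.spatial x ≠ 0) (n : ℕ) :
    HasFDerivAt (fun x : E4 ↦ c / E4.spatialNorm x ^ n)
      ((-(c * n) / E4.spatialNorm x ^ (n + 2)) • sdotCLM x) x := by
  have h := (Kerr.hasFDerivAt_const_div_norm_pow c hx n).comp x E4.spatial.hasFDerivAt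
  refine h.congr_fderiv ?_
  ext v
  rfl

variable {x : E4}

/-- The Kerr–Schild covector at `a = 0` as a function of the point and a constant vector:
`ℓ(V) = V⁰ + ⟪x⃗, V⃗⟫ / r` (Visser arXiv:0706.0622, (34)). [cite: arXiv07060622, (34)] -/
def ell (x V : E4) : ℝ := V 0 + sdot x V / E4.spatialNorm x

/-- The radial component `ν(V) = ⟪x⃗, V⃗⟫ / r = n⃗ · V⃗` (Visser arXiv:0706.0622, (34)). [cite: arXiv07060622, (34)] -/
def nu (x V : E4) : ℝ := sdot x V / E4.spatialNorm x

/-- The angular (projected) pairing `P(V, W) = ⟪V⃗, W⃗⟫ − ν(V) ν(W)`. [folklore] -/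
def proj (x V W : E4) : ℝ := sdot V W - sdot x V * sdot x W / E4.spatialNorm x ^ 2

/-- `ℓ = (1, x⃗/r)` is the Kerr–Schild covector at `a = 0`. [cite: arXiv07060622, (34)] -/
theorem nullCovector_zero_eq_ell (x V : E4) : Kerr.nullCovector 0 x V = ell x V :=
  Kerr.nullCovector_zero_spin_apply x V

/-- The directional derivative `∂_V ℓ(A) = ∂_V ν(A) = ⟪A⃗, V⃗⟫/r − ⟪x⃗, A⃗⟫⟪x⃗, V⃗⟫/r³ = P(V, A)/r`.
[folklore] -/
def dEll (x V A : E4) : ℝ :=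
  sdot A V / E4.spatialNorm x - sdot x A * sdot x V / E4.spatialNorm x ^ 3

/-- `∂_V ℓ(A) = P(V, A) / r`. [folklore] -/
theorem dEll_eq (x V A : E4) : dEll x V A = proj x V A / E4.spatialNorm x := by
  rw [dEll, proj, sdot_comm A V]
  by_cases hr : E4.spatialNorm x = 0
  · simp [hr]
  · field_simp

/-- The derivative of `x ↦ ℓ(A)` as a continuous linear map. [folklore] -/
def ellFD (x A : E4) : E4 →L[ℝ] ℝ :=
  (E4.spatialNorm x)⁻¹ • sdotCLM A - (sdot x A / E4.spatialNorm x ^ 3) • sdotCLM x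

/-- `ellFD x A V = ∂_V ℓ(A)`. [folklore] -/
@[simp]
theorem ellFD_apply (x A V : E4) : ellFD x A V = dEll x V A := by
  simp only [ellFD, dEll, sub_apply, FunLike.coe_smul,
    Pi.smul_apply, sdotCLM_apply, smul_eq_mul]
  ring

/-- **`x ↦ ℓ_x(A)` is differentiable off the time axis, with derivative `ellFD x A`.** [folklore] -/
theorem hasFDerivAt_ell (hx : E4.spatial x ≠ 0) (A : E4) :
    HasFDerivAt (fun x : E4 ↦ ell x A) (ellFD x A) x := by
  have h := ((hasFDerivAt_sdot_left x A).mul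
    (hasFDerivAt_const_div_spatialNorm_pow 1 hx 1)).const_add (A 0)
  have hfun : (fun x : E4 ↦ ell x A) = fun x ↦ A 0 + sdot x A * (1 / E4.spatialNorm x ^ 1) := by
    funext y; simp only [ell, pow_one]; ring
  rw [hfun]
  refine h.congr_fderiv ?_
  ext v
  simp only [ellFD_apply, dEll, add_apply, FunLike.coe_smul,
    Pi.smul_apply, sdotCLM_apply, smul_eq_mul, pow_one]
  have hr : E4.spatialNorm x ≠ 0 := by rwa [E4.spatialNorm, norm_ne_zero_iff]
  field_simp
  push_cast
  ring

/-- **`x ↦ ν_x(A)` is differentiable off the time axis, with the same derivative `ellFD x A`.**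
[folklore] -/
theorem hasFDerivAt_nu (hx : E4.spatial x ≠ 0) (A : E4) :
    HasFDerivAt (fun x : E4 ↦ nu x A) (ellFD x A) x := by
  have h := (hasFDerivAt_sdot_left x A).mul (hasFDerivAt_const_div_spatialNorm_pow 1 hx 1)
  have hfun : (fun x : E4 ↦ nu x A) = fun x ↦ sdot x A * (1 / E4.spatialNorm x ^ 1) := by
    funext y; simp only [nu, pow_one]; ring
  rw [hfun]
  refine h.congr_fderiv ?_
  ext v
  simp only [ellFD_apply, dEll, add_apply, FunLike.coe_smul,
    Pi.smul_apply, sdotCLM_apply, smul_eq_mul, pow_one]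
  have hr : E4.spatialNorm x ≠ 0 := by rwa [E4.spatialNorm, norm_ne_zero_iff]
  field_simp
  push_cast
  ring

/-- The directional derivative `∂_V P(A, B) = −(⟪x⃗,B⃗⟫⟪A⃗,V⃗⟫ + ⟪x⃗,A⃗⟫⟪B⃗,V⃗⟫)/r² + 2⟪x⃗,A⃗⟫⟪x⃗,B⃗⟫⟪x⃗,V⃗⟫/r⁴`
(`= −(P(V,A) ν(B) + ν(A) P(V,B))/r`). [folklore] -/
def dProj (x V A B : E4) : ℝ :=
  -(sdot x B * sdot A V + sdot x A * sdot B V) / E4.spatialNorm x ^ 2 +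
    2 * sdot x A * sdot x B * sdot x V / E4.spatialNorm x ^ 4

/-- `∂_V P(A, B) = −(P(V, A) ν(B) + ν(A) P(V, B)) / r`. [folklore] -/
theorem dProj_eq (x V A B : E4) :
    dProj x V A B = -(proj x V A * nu x B + nu x A * proj x V B) / E4.spatialNorm x := by
  rw [dProj, proj, proj, nu, nu, sdot_comm A V, sdot_comm B V]
  by_cases hr : E4.spatialNorm x = 0
  · simp [hr]
  · field_simp
    ring

/-- The derivative of `x ↦ P_x(A, B)` as a continuous linear map. [folklore] -/
def projFD (x A B : E4) : E4 →L[ℝ] ℝ :=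
  -((sdot x B / E4.spatialNorm x ^ 2) • sdotCLM A) - (sdot x A / E4.spatialNorm x ^ 2) • sdotCLM B +
    (2 * sdot x A * sdot x B / E4.spatialNorm x ^ 4) • sdotCLM x

/-- `projFD x A B V = ∂_V P(A, B)`. [folklore] -/
@[simp]
theorem projFD_apply (x A B V : E4) : projFD x A B V = dProj x V A B := by
  simp only [projFD, dProj, add_apply, sub_apply,
    neg_apply, FunLike.coe_smul, Pi.smul_apply, sdotCLM_apply,
    smul_eq_mul]
  ring

/-- **`x ↦ P_x(A, B)` is differentiable off the time axis, with derivative `projFD x A B`.**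
[folklore] -/
theorem hasFDerivAt_proj (hx : E4.spatial x ≠ 0) (A B : E4) :
    HasFDerivAt (fun x : E4 ↦ proj x A B) (projFD x A B) x := by
  have h := (((hasFDerivAt_sdot_left x A).mul (hasFDerivAt_sdot_left x B)).mul
    (hasFDerivAt_const_div_spatialNorm_pow 1 hx 2)).const_sub (sdot A B)
  have hfun : (fun x : E4 ↦ proj x A B) =
      fun x ↦ sdot A B - sdot x A * sdot x B * (1 / E4.spatialNorm x ^ 2) := by
    funext y; simp only [proj]; ring
  rw [hfun]
  refine h.congr_fderiv ?_
  ext v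
  simp only [projFD_apply, dProj, neg_apply, add_apply,
    FunLike.coe_smul, Pi.smul_apply, sdotCLM_apply, smul_eq_mul, Pi.mul_apply]
  have hr : E4.spatialNorm x ≠ 0 := by rwa [E4.spatialNorm, norm_ne_zero_iff]
  field_simp
  push_cast
  ring

/-! ### The metric components and their first derivatives -/

/-- The components of the Schwarzschild metric through the atoms:
`g(A, B) = −A⁰B⁰ + ⟪A⃗, B⃗⟫ + (2M/r) ℓ(A) ℓ(B)` off the time axis. [cite: arXiv07060622, (32)–(34)] -/
theorem bilin_zero_eq (M : ℝ) (hx : E4.spatial x ≠ 0) (A B : E4) :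
    Kerr.bilin M 0 x A B = -(A 0 * B 0) + sdot A B + 2 * M / E4.spatialNorm x * (ell x A * ell x B) := by
  have hr : E4.spatialNorm x ≠ 0 := by rwa [E4.spatialNorm, norm_ne_zero_iff]
  rw [Kerr.bilin_zero_spin_apply M hr]
  rfl

/-- The set `{x | x⃗ ≠ 0}` (off the time axis) is open. [folklore] -/
theorem isOpen_spatial_ne_zero : IsOpen {x : E4 | E4.spatial x ≠ 0} :=
  isOpen_ne.preimage E4.spatial.continuous

/-- The directional derivative `∂_V g(A, B)` of the Schwarzschild components:
`(∂_V (2M/r)) ℓ(A)ℓ(B) + (2M/r)(∂_Vℓ(A) ℓ(B) + ℓ(A) ∂_Vℓ(B))` with `∂_V(2M/r) = −2M⟪x⃗,V⃗⟫/r³`.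
[cite: KerrSchild1965, §2] -/
def dG (M : ℝ) (x V A B : E4) : ℝ :=
  -(2 * M) / E4.spatialNorm x ^ 3 * sdot x V * (ell x A * ell x B) +
    2 * M / E4.spatialNorm x * (dEll x V A * ell x B + ell x A * dEll x V B)

/-- **The first derivatives of the Schwarzschild components**: off the time axis,
`∂_V g(A, B) = dG M x V A B`, i.e.
`∂_V g(A,B) = (2M/r²)(−ν(V) ℓ(A) ℓ(B) + P(V, A) ℓ(B) + ℓ(A) P(V, B))`. [cite: KerrSchild1965, §2] -/
theorem fderiv_bilin_zero_spin_apply (M : ℝ) (hx : E4.spatial x ≠ 0) (V A B : E4) :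
    fderiv ℝ (Kerr.bilin M 0) x V A B = dG M x V A B := by
  have hr : 0 < Kerr.radius 0 x := by
    rw [Kerr.radius_zero_left, E4.spatialNorm]; exact norm_pos_iff.2 hx
  have hd : DifferentiableAt ℝ (Kerr.bilin M 0) x :=
    (Kerr.contDiffAt_bilin M 0 hr (n := 1)).differentiableAt one_ne_zero
  rw [← OpensChart.fderiv_apply₂ (Kerr.bilin M 0) hd]
  have heq : (fun y ↦ Kerr.bilin M 0 y A B) =ᶠ[𝓝 x]
      fun y ↦ -(A 0 * B 0) + sdot A B + 2 * M / E4.spatialNorm y ^ 1 * (ell y A * ell y B) := by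
    filter_upwards [isOpen_spatial_ne_zero.mem_nhds hx] with y hy
    rw [bilin_zero_eq M hy, pow_one]
  rw [heq.fderiv_eq]
  have h : HasFDerivAt
      (fun y : E4 ↦ -(A 0 * B 0) + sdot A B + 2 * M / E4.spatialNorm y ^ 1 * (ell y A * ell y B)) _ x :=
    (((hasFDerivAt_const_div_spatialNorm_pow (2 * M) hx 1).mul
      ((hasFDerivAt_ell hx A).mul (hasFDerivAt_ell hx B))).const_add (-(A 0 * B 0) + sdot A B))
  rw [h.fderiv]
  simp only [dG, add_apply, FunLike.coe_smul, Pi.smul_apply,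
    sdotCLM_apply, ellFD_apply, smul_eq_mul, Pi.mul_apply, pow_one]
  push_cast
  ring

end Schwarzschild

end Literature.Geometry.Lorentzian

end
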